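import Summits.ResolutionOfSingularities.ResolutionOfSingularities.Theorems.EquisingularLiftEquisingularLiftNatTowerInvDefs
import HarnessLib

/-!
# [OURS · L1 W4.5(b) · EL♮(3)] T23-A «TOWER WITH A BOUNDARY LIST» — THE ENGINE'S STAGE INVARIANT `Tower.InvB` (definitions + pure logic)

res-L1-w45b-stub-4 g10 (T23-A ENGINE OWNER; res-L1-w45b-lead-2 g4's sig draft `L/res-L1-w45b-lead-2/TowerRoundB.sig.lean` 86a5193cfa1b3f6a and
the engine word `L/res-L1-w45b-stub-4/T23A-ENGINE-WORD.md` 340f00d84dbcbbfc, 2026-08-28). Crux EL♮(3) = stmt-ResolutionOfSingularities-20148 (parent EL♮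
stmt-…-20038), route `EquisingularLift`, line `sections`; planner memo CRUX-PLAN v3.33 §II5. OURS; NOT a statement of any manuscript ([Hironaka2017] is a
candidate under adjudication, nothing of it is asserted); AI-written, weaker than expert review. Definitions + pure-logic projections only (no `sorry`,
no instance, no notation; standard axioms). `--supports stmt-ResolutionOfSingularities-20148 --as helper`.

WHAT. The B-tower's stage predicate has the arity `R G γ T E Es K` (lead-2): the ₅ stage `(G, γ, T, E, K)` — running strict transform `T`, running
exceptional surface `E`, cone shadow `K` — plus the LIST `Es : List (Set G)` of RETAINED older exceptional surfaces. The engine's invariant at that arity is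
`Tower.InvB … G γ T E Es K`: the `Tower.Inv₃` invariant of the ₆ engine (…NatTowerInvDefs, res-D-pv-029) whose upstairs `Ch`-stage `(X, σ, S, jG, tG)` carries,
BESIDES the running surface's datum `Tower.Exc₃ … E hE K X σ jG` (with the cone shadow), for EVERY retained member `F ∈ Es` the SHADOW-FORGOTTEN datum
`Tower.Exc₃ … F hF ∅ X σ jG` (no round is cone-witnessed along a retained member) in the SAME stage `X`, together with the downstairs bookkeeping
`IsClosed F ∧ ¬ T ⊆ F`. One upstairs stage for all members is forced: a round hosted by a member lifts its centre inside THAT member's model, and the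
other members are transported through the same blow-up (engine word §ENGINE COST).
* `Tower.StageB` — the body of the invariant at an EXPLICIT upstairs stage (the currency of the explicit-stage step bricks of the B engine).
* `Tower.InvB` — context + downstairs bookkeeping + `∃ stage, StageB`.
* pure logic: `exc₃_forgetShadow`, `invB_inv₃` (forget the list), `invB_inv₃_of_mem` (a retained member as a running surface with `K := ∅`),
  `invB_nil_of_inv₃` (`Es := []`), `invB_of_sublist` (drop members), `invB_cons_running` (retain the running surface itself, shadow forgotten), `invB_final`.
-/

set_option linter.dupNamespace false -- mandated namespace `Summit.<Summit>.<Problem>` of this single-conjunct summit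

noncomputable section

open CategoryTheory CategoryTheory.Limits AlgebraicGeometry TopologicalSpace Topology IsLocalRing
open Literature.AlgebraicGeometry.Resolution
open AlgebraicGeometry.Scheme.IdealSheafData

namespace Summit.ResolutionOfSingularities.ResolutionOfSingularities.Cruxes.EquisingularLiftNat.Sections.Tower

variable (O : Type) [CommRing O] (k : Type) [Field k] (θ : O →+* k)
  (P : Scheme.{0}) (q : P ⟶ Spec (.of O)) (Y : Set P) (Ch : ∀ X' : Scheme.{0}, (X' ⟶ P) → Set X' → Prop)

/-- **The B-stage body at an explicit upstairs stage `(X, σ, S, jG, tG)`**: the `Ch`-stage clauses and the model square of `Tower.Inv₃`, the running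
surface's datum `Exc₃ … E hE K` (cone shadow coupled to `E` only) and, for every retained member `F ∈ Es`, the shadow-forgotten datum `Exc₃ … F hF ∅`
in the SAME stage. [OURS · L1 W4.5b · T23-A engine] -/
def StageB (Ruled : RuledDatum P) {F₉ : Scheme.{0}} (Z₉ : Set F₉) (hZ₉ : IsClosed Z₉) {F₁₀ : Scheme.{0}} (υ' : F₁₀ ⟶ F₉)
    (G : Scheme.{0}) (γ : G ⟶ F₁₀) (T E : Set G) (Es : List (Set G)) (K : Set G)
    (X : Scheme.{0}) (σ : X ⟶ P) (S : Set X) (jG : G ⟶ X) (tG : G ⟶ Spec (.of k)) : Prop :=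
  Ch X σ S ∧ IsIntegral X ∧ IsLocallyNoetherian X ∧ Scheme.IsRegular X ∧ IsDominant (σ ≫ q) ∧
  IsPullback jG tG (σ ≫ q) (Spec.map (CommRingCat.ofHom θ)) ∧ jG '' T = S ∧
  (∀ hE : IsClosed E, Exc₃ O P q Y Ruled Z₉ hZ₉ υ' G γ E hE K X σ jG) ∧
  (∀ F ∈ Es, ∀ hF : IsClosed F, Exc₃ O P q Y Ruled Z₉ hZ₉ υ' G γ F hF ∅ X σ jG)

/-- **The B-tower stage invariant `Tower.InvB … G γ T E Es K`** (arity of res-L1-w45b-lead-2's `TowerPtRegB`/`TowerPtRamB`/`TowerRoundB` stage predicate):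
`Tower.Inv₃`'s context and downstairs bookkeeping, `IsClosed F ∧ ¬ T ⊆ F` for every retained member, and ONE upstairs stage carrying `StageB`.
[OURS · L1 W4.5b · T23-A engine] -/
def InvB (Ruled : RuledDatum P) (F₉ : Scheme.{0}) (Z₉ : Set F₉) (hZ₉ : IsClosed Z₉) (F₁₀ : Scheme.{0}) (υ' : F₁₀ ⟶ F₉)
    (G : Scheme.{0}) (γ : G ⟶ F₁₀) (T E : Set G) (Es : List (Set G)) (K : Set G) : Prop :=
  IsBlowup υ' (vanishingIdeal (⟨Z₉, hZ₉⟩ : Closeds F₉)) ∧ Z₉.Infinite ∧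
  IsIntegral G ∧ IsClosed T ∧ IsIrreducible T ∧ IsClosed E ∧ ¬ T ⊆ E ∧
  (∀ F ∈ Es, IsClosed F ∧ ¬ T ⊆ F) ∧
  ∃ (X : Scheme.{0}) (σ : X ⟶ P) (S : Set X) (jG : G ⟶ X) (tG : G ⟶ Spec (.of k)),
    StageB O k θ P q Y Ch Ruled Z₉ hZ₉ υ' G γ T E Es K X σ S jG tG

/-! ## Pure-logic projections -/

/-- Forgetting the cone shadow in an exceptional-surface datum (`K ↦ ∅`). [OURS · pure logic] -/
theorem exc₃_forgetShadow (Ruled : RuledDatum P) {F₉ : Scheme.{0}} {Z₉ : Set F₉} {hZ₉ : IsClosed Z₉} {F₁₀ : Scheme.{0}} {υ' : F₁₀ ⟶ F₉}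
    {G : Scheme.{0}} {γ : G ⟶ F₁₀} {E : Set G} {hE : IsClosed E} {K : Set G} {X : Scheme.{0}} {σ : X ⟶ P} {jG : G ⟶ X}
    (h : Exc₃ O P q Y Ruled Z₉ hZ₉ υ' G γ E hE K X σ jG) : Exc₃ O P q Y Ruled Z₉ hZ₉ υ' G γ E hE ∅ X σ jG := by
  rcases h with h | ⟨𝓔, h1, h2, h3, h4, h5, -⟩
  · exact Or.inl h
  · exact Or.inr ⟨𝓔, h1, h2, h3, h4, h5, Or.inl rfl⟩

/-- `Tower.InvB ⇒ Tower.Inv₃` for the running surface (forget the retained list). [OURS · pure logic] -/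
theorem invB_inv₃ (Ruled : RuledDatum P) (F₉ : Scheme.{0}) (Z₉ : Set F₉) (hZ₉ : IsClosed Z₉) (F₁₀ : Scheme.{0}) (υ' : F₁₀ ⟶ F₉)
    (G : Scheme.{0}) (γ : G ⟶ F₁₀) (T E : Set G) (Es : List (Set G)) (K : Set G)
    (h : InvB O k θ P q Y Ch Ruled F₉ Z₉ hZ₉ F₁₀ υ' G γ T E Es K) : Inv₃ O k θ P q Y Ch Ruled F₉ Z₉ hZ₉ F₁₀ υ' G γ T E K := by
  obtain ⟨h1, h2, h3, h4, h5, h6, h7, -, X, σ, S, jG, tG, hCh, hX, hXn, hXr, hdom, hsq, hTS, hE, -⟩ := h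
  exact ⟨h1, h2, h3, h4, h5, h6, h7, X, σ, S, jG, tG, hCh, hX, hXn, hXr, hdom, hsq, hTS, hE⟩

/-- `Tower.InvB ⇒ Tower.Inv₃` for a RETAINED member as running surface, shadow forgotten (`K := ∅`). [OURS · pure logic] -/
theorem invB_inv₃_of_mem (Ruled : RuledDatum P) (F₉ : Scheme.{0}) (Z₉ : Set F₉) (hZ₉ : IsClosed Z₉) (F₁₀ : Scheme.{0}) (υ' : F₁₀ ⟶ F₉)
    (G : Scheme.{0}) (γ : G ⟶ F₁₀) (T E : Set G) (Es : List (Set G)) (K : Set G)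
    (h : InvB O k θ P q Y Ch Ruled F₉ Z₉ hZ₉ F₁₀ υ' G γ T E Es K) {F : Set G} (hF : F ∈ Es) :
    Inv₃ O k θ P q Y Ch Ruled F₉ Z₉ hZ₉ F₁₀ υ' G γ T F ∅ := by
  obtain ⟨h1, h2, h3, h4, h5, -, -, hEs, X, σ, S, jG, tG, hCh, hX, hXn, hXr, hdom, hsq, hTS, -, hF'⟩ := h
  exact ⟨h1, h2, h3, h4, h5, (hEs F hF).1, (hEs F hF).2, X, σ, S, jG, tG, hCh, hX, hXn, hXr, hdom, hsq, hTS, hF' F hF⟩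

/-- `Tower.Inv₃ ⇒ Tower.InvB` with the EMPTY retained list (the seed of `ReachTowerB`, and the ₆ ⊆ B embedding). [OURS · pure logic] -/
theorem invB_nil_of_inv₃ (Ruled : RuledDatum P) (F₉ : Scheme.{0}) (Z₉ : Set F₉) (hZ₉ : IsClosed Z₉) (F₁₀ : Scheme.{0}) (υ' : F₁₀ ⟶ F₉)
    (G : Scheme.{0}) (γ : G ⟶ F₁₀) (T E K : Set G) (h : Inv₃ O k θ P q Y Ch Ruled F₉ Z₉ hZ₉ F₁₀ υ' G γ T E K) :
    InvB O k θ P q Y Ch Ruled F₉ Z₉ hZ₉ F₁₀ υ' G γ T E [] K := by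
  obtain ⟨h1, h2, h3, h4, h5, h6, h7, X, σ, S, jG, tG, hCh, hX, hXn, hXr, hdom, hsq, hTS, hE⟩ := h
  exact ⟨h1, h2, h3, h4, h5, h6, h7, fun F hF => by simp at hF, X, σ, S, jG, tG, hCh, hX, hXn, hXr, hdom, hsq, hTS, hE,
    fun F hF => by simp at hF⟩

/-- Dropping retained members (any sub-family, as the B-steps allow). [OURS · pure logic] -/
theorem invB_of_sublist (Ruled : RuledDatum P) (F₉ : Scheme.{0}) (Z₉ : Set F₉) (hZ₉ : IsClosed Z₉) (F₁₀ : Scheme.{0}) (υ' : F₁₀ ⟶ F₉)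
    (G : Scheme.{0}) (γ : G ⟶ F₁₀) (T E : Set G) (Es Es' : List (Set G)) (K : Set G)
    (h : InvB O k θ P q Y Ch Ruled F₉ Z₉ hZ₉ F₁₀ υ' G γ T E Es K) (hsub : ∀ F ∈ Es', F ∈ Es) :
    InvB O k θ P q Y Ch Ruled F₉ Z₉ hZ₉ F₁₀ υ' G γ T E Es' K := by
  obtain ⟨h1, h2, h3, h4, h5, h6, h7, hEs, X, σ, S, jG, tG, hCh, hX, hXn, hXr, hdom, hsq, hTS, hE, hF'⟩ := h
  exact ⟨h1, h2, h3, h4, h5, h6, h7, fun F hF => hEs F (hsub F hF), X, σ, S, jG, tG, hCh, hX, hXn, hXr, hdom, hsq, hTS, hE,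
    fun F hF => hF' F (hsub F hF)⟩

/-- Retaining the running surface itself (shadow forgotten) — the «`F = host`» case of the round transport at the running host.
[OURS · pure logic] -/
theorem invB_cons_running (Ruled : RuledDatum P) (F₉ : Scheme.{0}) (Z₉ : Set F₉) (hZ₉ : IsClosed Z₉) (F₁₀ : Scheme.{0}) (υ' : F₁₀ ⟶ F₉)
    (G : Scheme.{0}) (γ : G ⟶ F₁₀) (T E : Set G) (Es : List (Set G)) (K : Set G)
    (h : InvB O k θ P q Y Ch Ruled F₉ Z₉ hZ₉ F₁₀ υ' G γ T E Es K) :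
    InvB O k θ P q Y Ch Ruled F₉ Z₉ hZ₉ F₁₀ υ' G γ T E (E :: Es) K := by
  obtain ⟨h1, h2, h3, h4, h5, h6, h7, hEs, X, σ, S, jG, tG, hCh, hX, hXn, hXr, hdom, hsq, hTS, hE, hF'⟩ := h
  refine ⟨h1, h2, h3, h4, h5, h6, h7, ?_, X, σ, S, jG, tG, hCh, hX, hXn, hXr, hdom, hsq, hTS, hE, ?_⟩
  · intro F hF
    rcases List.mem_cons.mp hF with rfl | hF
    · exact ⟨h6, h7⟩
    · exact hEs F hF
  · intro F hF hFcl
    rcases List.mem_cons.mp hF with rfl | hF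
    · exact exc₃_forgetShadow O P q Y Ruled (hE hFcl)
    · exact hF' F hF hFcl

/-- **The B-driver's (final) clause from `Tower.InvB`.** [OURS · pure logic] -/
theorem invB_final (Ruled : RuledDatum P) (F₉ : Scheme.{0}) (Z₉ : Set F₉) (hZ₉ : IsClosed Z₉) (F₁₀ : Scheme.{0}) (υ' : F₁₀ ⟶ F₉)
    (G : Scheme.{0}) (γ : G ⟶ F₁₀) (T E : Set G) (Es : List (Set G)) (K : Set G)
    (h : InvB O k θ P q Y Ch Ruled F₉ Z₉ hZ₉ F₁₀ υ' G γ T E Es K) :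
    ∃ (X₉ : Scheme.{0}) (σ₉ : X₉ ⟶ P) (S₉ : Set X₉) (j₉ : G ⟶ X₉) (t₉ : G ⟶ Spec (.of k)),
      Ch X₉ σ₉ S₉ ∧ IsIntegral X₉ ∧ IsLocallyNoetherian X₉ ∧ Scheme.IsRegular X₉ ∧ IsDominant (σ₉ ≫ q) ∧
      IsPullback j₉ t₉ (σ₉ ≫ q) (Spec.map (CommRingCat.ofHom θ)) ∧ j₉ '' T = S₉ ∧ IsClosed T ∧ IsIrreducible T ∧ IsIntegral G :=
  inv₃_final O k θ P q Y Ch Ruled F₉ Z₉ hZ₉ F₁₀ υ' G γ T E K (invB_inv₃ O k θ P q Y Ch Ruled F₉ Z₉ hZ₉ F₁₀ υ' G γ T E Es K h)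

end Summit.ResolutionOfSingularities.ResolutionOfSingularities.Cruxes.EquisingularLiftNat.Sections.Tower

end
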